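import Summits.QuantumFields.YangMills.Theorems.BalabanUVNodesN16HolderAtRecord13OfEdges
import Summits.QuantumFields.YangMills.Theorems.BalabanUVNodesN16SlotWindowAllTorus

/-!
# Route «BalabanUVNodes», cluster K4 «SpineRates» — node N16 = NE3: PER FAMILY, LETTERS CHOSEN FROM THE TWO IN-EDGES WITH «PROVISO ∧ AT-KEYED SLOT ∧ N21's NUMERALS»
# (β = 1 ∕ R-β ∕ R-β″) — twins of this seat's STAGE-FREE per-family lemmas `exists_letters_inEndRegime_leafSlot_of_edges` (module 27 `…N16AtRecord13OfEdges` §2, p502350),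
# `exists_letters_inEndRegimeHMS_leafSlotHolderMS_of_edges` (27 §3) and `exists_letters_inEndRegimeH_leafSlotHolder_of_edges` (module 28 `…N16HolderAtRecord13OfEdges`,
# p502915) with node N05's `Thm4Body` ∕ `Prop3Body` read on the ALL-TORUS PROPER sub-family (module 32's slots `LeafSlotAT` ∕ `LeafSlotHolderAT` ∕ `LeafSlotHolderMSAT`)

Cell `pub-ymgap`, seat `pub-ymgap-dag-n16-e` (R134 acceleration seat (a), strategy s2 = BY-NAME KNIT at the record; HUMAN RULING D-0062; chair R424 venue), generation 7,
module 35 (THEOREMS ONLY, 0 `def`, 0 `sorry`, standard axioms; STAGE-FREE and EDITION-FREE — no record key is read).  `--kind proof --supports <K3 id of record> --as helper`.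
`bears_on: R4∕N16 · edges N05 → N16, N07 → N16 · out-edge N16 → N21`.  Over module 28 (through it 27 §1's slot-free letter witness `exists_window_letters_linearLeaf`, files 13∕18∕26's
proviso lemmas `inEndRegime(H∕HMS)_ofRecord_of_window`, the threshold positivity lemmas) and module 33 `…N16SlotWindowAllTorus` (the AT window recipes).  Statements = the three
landed per-family statements with the N05 family's index subtype swapped and the slot renamed; proofs verbatim.  Restates nothing.

WHY (LOCATED-4 of this seat; modules 32–34).  These are the per-family «letters chosen» steps from which the reading-level theorems «N16 at the reading of record FROM ITS TWO
IN-EDGES BY NAME» (27∕28 and their ⁗∕Co twins) are assembled by `choose`; with N05's conjunct at the all-torus proper members they are the steps the Co-home AT lines (next module,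
after dag-n22-e's Co homes) compose — and the ones n16-c's R-b″ tops ∕ n05-a's per-member currency can feed.  IN-EDGE INTERFACES (unchanged but for the sub-index): N05 = the
unpacked leaf `∃ len c₁ c₁' B₁' cP C₂ B₀β inp, … ∧ Thm4Body … ∧ Prop3Body …` on `fun i : {i : ZdIdx 4 F.L // (∀ j, i.Ω j = univ) ∧ … ∧ i.η = ((F.L : ℝ)⁻¹) ^ i.k} ↦ zdGF3 (M_N ℂ) F.L β len i.1`; N07 = the
linear leaf `∃ C ε₀, 0 ≤ C ∧ 0 < ε₀ ∧ ∀ ε ∈ ]0, ε₀], LeafH3sup 4 F.L (ne3NperOfRecord₁₁ F 0 0) ε (C·ε) (C·ε) (ne3DomOfRecord₁₁ F N 0 0)`.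

CONTENT.  §1 `exists_letters_inEndRegime_leafSlotAT_of_edges` (β = 1; `ℓ.Λ₁ = radiusOfRecord …`, `ℓ.C = constOfRecord … g`); §2 `exists_letters_inEndRegimeH_leafSlotHolderAT_of_edges`
(`radiusOfRecordH` ∕ `constOfRecordH`); §3 `exists_letters_inEndRegimeHMS_leafSlotHolderMSAT_of_edges` (`radiusOfRecordHMS` ∕ `constOfRecordHMS`, MS length letter).  Each also
returns dag-n21-d's numerals `0 < ℓ.b`, `512·5·8·L²·ℓ.b ≤ 1`, `0 < ℓ.Λ₂'`.

HONEST FRAMING.  Kernel bookkeeping (a letter witness on displayed lines); no estimate; N05's `Thm4Body` ∕ `Prop3Body` ([Balaban1985RegularSpaces] Thm 4 ∕ Prop 3 TYPES, all-torus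
proper members) and N07's linear `LeafH3sup` ([Balaban1985Variational] Thm 1 (8)+(10) TYPE) are HYPOTHESES asserted for no family; nothing of Bałaban's asserted; **N16 ∕ NE3 is NOT
discharged**; the Hölder-pin ruling and N05's index law untouched; count-neutral (typed 28∕28 · discharged 5∕27, A 5∕28 UNMOVED); one finite four-torus at fixed ε — NOT ℝ⁴, NOT
infinite volume, NOT OS, NOT a mass gap, NOT Clay.
-/

set_option autoImplicit false

open scoped BigOperators Matrix Matrix.Norms.L2Operator
open NormedSpace

namespace Summit.QuantumFields.YangMills.BalabanUVNodes.N16LettersOfEdgesAllTorus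

open Literature.MathematicalPhysics.QuantumFieldTheory.Balaban1983to89
open Literature.MathematicalPhysics.QuantumFieldTheory.Balaban1983to89.T4Continuum (T4Family ULoop)
open B7Prop1Explicit B7Prop2Explicit
open B7Prop3Flat (c3)
open B8LeafModelZd (ZdIdx)
open B8LeafModelZd3 (zdGF3)
open Node00 (NE3Objects₁₁ NE3Letters₁₁ ne3ConstLayerOfRecord₁₁ ne3NperOfRecord₁₁ ne3DomOfRecord₁₁ one_le_ne3NperOfRecord₁₁)
open Summit.QuantumFields.BalabanUV.T4Continuum
open BlockAverageCurrent (curConst)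
open NE3RightInverseSupLetters (frameC)
open NE3.LeafIndexSockets (LeafH3sup)
open YMDAG.UVSplit (NE3Carriers ne3OfRecord₁₁)
open Summit.QuantumFields.YangMills.BalabanUVNodes.N16Regime (InEndRegime radiusOfRecord constOfRecord)
open Summit.QuantumFields.YangMills.BalabanUVNodes.N16AtRRec12OfRecord (radiusOfRecord_ofRecord_pos)
open Summit.QuantumFields.YangMills.BalabanUVNodes.N16HolderRegime (InEndRegimeH radiusOfRecordH constOfRecordH radiusOfRecordH_pos)
open Summit.QuantumFields.YangMills.BalabanUVNodes.N16HolderMSRegime (InEndRegimeHMS radiusOfRecordHMS constOfRecordHMS radiusOfRecordHMS_pos)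
open Summit.QuantumFields.YangMills.BalabanUVNodes.N16SlotWindow (inEndRegime_ofRecord_of_window)
open Summit.QuantumFields.YangMills.BalabanUVNodes.N16HolderSlotWindow (inEndRegimeH_ofRecord_of_window)
open Summit.QuantumFields.YangMills.BalabanUVNodes.N16HolderMSSlotWindow (inEndRegimeHMS_ofRecord_of_window)
open Summit.QuantumFields.YangMills.BalabanUVNodes.N16AtRecord13OfEdges (exists_window_letters_linearLeaf)
open Summit.QuantumFields.YangMills.BalabanUVNodes.N16LeafSlotAllTorus (LeafSlotAT LeafSlotHolderAT LeafSlotHolderMSAT)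
open Summit.QuantumFields.YangMills.BalabanUVNodes.N16SlotWindowAllTorus (leafSlotHolderAT_ofRecord_of_window_linear leafSlotHolderMSAT_ofRecord_of_window_linear)

noncomputable section

variable {N : ℕ} [NeZero N]

/-! ## §1 β = 1: letters with THE END's proviso, the AT-keyed slot of record and N21's numerals, per family -/

/-- **PER FAMILY: LETTERS WITH THE END's PROVISO, n16-e's `LeafSlotAT`, AND N21's NUMERALS, FROM THE TWO IN-EDGES** (β = 1) — N05's Thm-4 ∕ Prop-3 bodies on the ALL-TORUS PROPER sub-family of
`zdGF3 (M_N ℂ) F.L 1 len` with their constants and window (unpacked leaf of record), N07's linear leaf `LeafH3sup … ε (C·ε) (C·ε)` for `0 < ε ≤ ε₀` at RR-1's period and data of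
record, and a coupling letter `g > 0` give letters `ℓ` (`ℓ.g = g`, `ℓ.Λ₁ =` THE END's radius of record, `ℓ.C =` its constant) at which `InEndRegime ∧ LeafSlotAT` holds at RR-1's object
(§1 ∘ file 13's `inEndRegime_ofRecord_of_window` ∘ module 33's `leafSlotHolderAT_ofRecord_of_window_linear` (β = 1) with `b' = c' = C·ℓ.ε`) together with N21's numerals. [folklore] -/
theorem exists_letters_inEndRegime_leafSlotAT_of_edges (F : T4Family) {g : ℝ} (hg : 0 < g)
    (h5 : letI : CStarAlgebra (Matrix (Fin N) (Fin N) ℂ) := {}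
      ∃ (len : Site 4 → ℝ) (c₁ c₁' B₁' cP C₂ B₀β : ℝ) (inp : B8.B9Inputs),
        (∀ v : Site 4, 0 < len v → 1 ≤ len v) ∧ (∀ μ : Fin 4, len (e μ) = 1) ∧ 0 < B₁' ∧ 5 * ((4 : ℕ) : ℝ) * F.L * inp.B₀ ≤ B₁' ∧ 0 < c₁' ∧
        (∀ α₀ α₁ : ℝ, 0 < α₀ → 0 < α₁ → α₀ + α₁ ≤ c₁' →
          α₀ + α₁ ≤ c₁ ∧ C0 4 * (2 * α₀) ≤ 1 / 3 ∧ 4 * α₀ ≤ c2' 4 F.L ∧ 16 * (B₁' * (α₀ + α₁)) ≤ 1 ∧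
          Real.exp (4 * (800 * (((4 : ℕ) : ℝ) + 1) ^ 2 * (((4 : ℕ) : ℝ) + 4)) * α₀) * (1 + 8 * (131072 * (((4 : ℕ) : ℝ) + 1) ^ 2) * (B₁' * (α₀ + α₁))) ≤ 2 ∧
          2 * (B₁' * (α₀ + α₁)) ≤ c3 4 F.L ∧ ((4 : ℕ) : ℝ) * F.L * α₁ ≤ 1 / 8 ∧ α₀ ≤ cP ∧ α₁ ≤ cP ∧ B₁' * (α₀ + α₁) ≤ cP ∧
          2 * (B₁' * (α₀ + α₁)) ^ 2 + 20 * ((4 : ℕ) : ℝ) * α₀ * (B₁' * (α₀ + α₁)) + 2 * C₂ * (B₁' * (α₀ + α₁)) ^ 2 ≤ α₀ + α₁) ∧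
        B8.Thm4Body c₁ B₁' (fun i : {i : ZdIdx 4 F.L // (∀ j, i.Ω j = Set.univ) ∧ (∀ m j, i.Λs m j = {_y | j = m}) ∧ (∀ m j, i.Λb m j = {_c | j = m}) ∧ i.η = ((F.L : ℝ)⁻¹) ^ i.k} => (zdGF3 (Matrix (Fin N) (Fin N) ℂ) F.L 1 len i.1).toGFData) ∧
        B8.Prop3Body cP 4 (F.L : ℝ) C₂ inp B₀β (fun i : {i : ZdIdx 4 F.L // (∀ j, i.Ω j = Set.univ) ∧ (∀ m j, i.Λs m j = {_y | j = m}) ∧ (∀ m j, i.Λb m j = {_c | j = m}) ∧ i.η = ((F.L : ℝ)⁻¹) ^ i.k} => (zdGF3 (Matrix (Fin N) (Fin N) ℂ) F.L 1 len i.1).toGFData2))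
    (h7 : ∃ C ε₀ : ℝ, 0 ≤ C ∧ 0 < ε₀ ∧ ∀ ε : ℝ, 0 < ε → ε ≤ ε₀ →
      LeafH3sup 4 F.L (ne3NperOfRecord₁₁ F 0 0) ε (C * ε) (C * ε) (ne3DomOfRecord₁₁ F N 0 0)) :
    ∃ ℓ : NE3Letters₁₁, ℓ.g = g ∧ ℓ.Λ₁ = radiusOfRecord N F.L (ne3NperOfRecord₁₁ F 0 0) ∧ ℓ.C = constOfRecord N F.L (ne3NperOfRecord₁₁ F 0 0) g ∧
      0 < ℓ.b ∧ 512 * (4 + 1) * (4 + 4) * (F.L : ℝ) ^ 2 * ℓ.b ≤ 1 ∧ 0 < ℓ.Λ₂' ∧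
      InEndRegime (ne3OfRecord₁₁ F (ne3ConstLayerOfRecord₁₁ F N ℓ)) ∧ LeafSlotAT (ne3OfRecord₁₁ F (ne3ConstLayerOfRecord₁₁ F N ℓ)) := by
  letI : CStarAlgebra (Matrix (Fin N) (Fin N) ℂ) := {}
  obtain ⟨len, c₁, c₁', B₁', cP, C₂, B₀β, inp, hlen, hlen1, hB₁', hBB, hc₁', hwin, hT, hP⟩ := h5
  obtain ⟨C, ε₀, hC, hε₀, h3⟩ := h7
  obtain ⟨α, ℓ, hα, hα1, hα2, hα3, hα4, hα5, hgℓ, hε0, hε, hεε₀, hCε, hεr, hΛ₁, hb0, hb, hCℓ, hΛ₂', hΛ₂'0, hnum⟩ :=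
    exists_window_letters_linearLeaf F hc₁' inp B₀β g (radiusOfRecord_ofRecord_pos (N := N) F) (constOfRecord N F.L (ne3NperOfRecord₁₁ F 0 0) g) hC hε₀
  have hB0 : 0 < 5 * ((4 : ℕ) : ℝ) * F.L * inp.B₀ := by have := inp.B₀_pos; have := HistoryFlow.two_le_L F; positivity
  have hΛpos : 0 < ℓ.Λ₁ := by rw [hΛ₁]; exact radiusOfRecord_ofRecord_pos (N := N) F
  have hgpos : 0 < ℓ.g := by rw [hgℓ]; exact hg
  refine ⟨ℓ, hgℓ, hΛ₁, hCℓ, hb0, hnum, hΛ₂'0,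
    inEndRegime_ofRecord_of_window F (ne3ConstLayerOfRecord₁₁ F N ℓ) (one_le_ne3NperOfRecord₁₁ F 0 0) hgpos hB0.le hα2 hε0 hε hΛ₁.le hb0.le hb
      (show constOfRecord N F.L (ne3NperOfRecord₁₁ F 0 0) ℓ.g ≤ ℓ.C by rw [hCℓ, hgℓ]), ?_⟩
  have hCε0 : 0 ≤ C * ℓ.ε := mul_nonneg hC hε0.le
  exact leafSlotHolderAT_ofRecord_of_window_linear F (ne3ConstLayerOfRecord₁₁ F N ℓ) hlen hlen1 hB₁' hBB hc₁' hwin hα hα1 hα2 hα3 hα4 hα5 hε hΛpos hΛ₂' hCε0 hCε hCε0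
    (hCε.trans (by linarith only [hα.le] : α / 2048 ≤ α / 24)) hT hP (h3 ℓ.ε hε0 hεε₀)

/-! ## §2 Exponent `β ∈ [0, 1]` (R-β): letters with the β-uniform proviso, the AT-keyed leaf β-slot and N21's numerals, per family -/

section Holder

variable {β : ℝ}

/-- **PER FAMILY, R-β: LETTERS WITH THE β-UNIFORM PROVISO, dag-n16-c's LEAF β-SLOT, AND N21's NUMERALS, FROM THE TWO IN-EDGES** — N05's Thm-4 ∕ Prop-3 bodies on the ALL-TORUS PROPER
sub-family of `zdGF3 (M_N ℂ) F.L β len` with their constants and window, N07's linear leaf `LeafH3sup … ε (C·ε) (C·ε)` for `0 < ε ≤ ε₀`, and a coupling letter `g > 0` give letters `ℓ`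
(`ℓ.g = g`, `ℓ.Λ₁ = radiusOfRecordH …`, `ℓ.C = constOfRecordH … g`) at which `InEndRegimeH ∧ LeafSlotHolderAT · β` holds at RR-1's object (module 27 §1 ∘ (F2)'s
`inEndRegimeH_ofRecord_of_window` ∘ module 33's `leafSlotHolderAT_ofRecord_of_window_linear` with `b' = c' = C·ℓ.ε`) together with N21's numerals. [folklore] -/
theorem exists_letters_inEndRegimeH_leafSlotHolderAT_of_edges (F : T4Family) {g : ℝ} (hg : 0 < g)
    (h5 : letI : CStarAlgebra (Matrix (Fin N) (Fin N) ℂ) := {}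
      ∃ (len : Site 4 → ℝ) (c₁ c₁' B₁' cP C₂ B₀β : ℝ) (inp : B8.B9Inputs),
        (∀ v : Site 4, 0 < len v → 1 ≤ len v) ∧ (∀ μ : Fin 4, len (e μ) = 1) ∧ 0 < B₁' ∧ 5 * ((4 : ℕ) : ℝ) * F.L * inp.B₀ ≤ B₁' ∧ 0 < c₁' ∧
        (∀ α₀ α₁ : ℝ, 0 < α₀ → 0 < α₁ → α₀ + α₁ ≤ c₁' →
          α₀ + α₁ ≤ c₁ ∧ C0 4 * (2 * α₀) ≤ 1 / 3 ∧ 4 * α₀ ≤ c2' 4 F.L ∧ 16 * (B₁' * (α₀ + α₁)) ≤ 1 ∧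
          Real.exp (4 * (800 * (((4 : ℕ) : ℝ) + 1) ^ 2 * (((4 : ℕ) : ℝ) + 4)) * α₀) * (1 + 8 * (131072 * (((4 : ℕ) : ℝ) + 1) ^ 2) * (B₁' * (α₀ + α₁))) ≤ 2 ∧
          2 * (B₁' * (α₀ + α₁)) ≤ c3 4 F.L ∧ ((4 : ℕ) : ℝ) * F.L * α₁ ≤ 1 / 8 ∧ α₀ ≤ cP ∧ α₁ ≤ cP ∧ B₁' * (α₀ + α₁) ≤ cP ∧
          2 * (B₁' * (α₀ + α₁)) ^ 2 + 20 * ((4 : ℕ) : ℝ) * α₀ * (B₁' * (α₀ + α₁)) + 2 * C₂ * (B₁' * (α₀ + α₁)) ^ 2 ≤ α₀ + α₁) ∧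
        B8.Thm4Body c₁ B₁' (fun i : {i : ZdIdx 4 F.L // (∀ j, i.Ω j = Set.univ) ∧ (∀ m j, i.Λs m j = {_y | j = m}) ∧ (∀ m j, i.Λb m j = {_c | j = m}) ∧ i.η = ((F.L : ℝ)⁻¹) ^ i.k} => (zdGF3 (Matrix (Fin N) (Fin N) ℂ) F.L β len i.1).toGFData) ∧
        B8.Prop3Body cP 4 (F.L : ℝ) C₂ inp B₀β (fun i : {i : ZdIdx 4 F.L // (∀ j, i.Ω j = Set.univ) ∧ (∀ m j, i.Λs m j = {_y | j = m}) ∧ (∀ m j, i.Λb m j = {_c | j = m}) ∧ i.η = ((F.L : ℝ)⁻¹) ^ i.k} => (zdGF3 (Matrix (Fin N) (Fin N) ℂ) F.L β len i.1).toGFData2))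
    (h7 : ∃ C ε₀ : ℝ, 0 ≤ C ∧ 0 < ε₀ ∧ ∀ ε : ℝ, 0 < ε → ε ≤ ε₀ →
      LeafH3sup 4 F.L (ne3NperOfRecord₁₁ F 0 0) ε (C * ε) (C * ε) (ne3DomOfRecord₁₁ F N 0 0)) :
    ∃ ℓ : NE3Letters₁₁, ℓ.g = g ∧ ℓ.Λ₁ = radiusOfRecordH N F.L (ne3NperOfRecord₁₁ F 0 0) ∧ ℓ.C = constOfRecordH N F.L (ne3NperOfRecord₁₁ F 0 0) g ∧
      0 < ℓ.b ∧ 512 * (4 + 1) * (4 + 4) * (F.L : ℝ) ^ 2 * ℓ.b ≤ 1 ∧ 0 < ℓ.Λ₂' ∧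
      InEndRegimeH (ne3OfRecord₁₁ F (ne3ConstLayerOfRecord₁₁ F N ℓ)) ∧ LeafSlotHolderAT (ne3OfRecord₁₁ F (ne3ConstLayerOfRecord₁₁ F N ℓ)) β := by
  letI : CStarAlgebra (Matrix (Fin N) (Fin N) ℂ) := {}
  obtain ⟨len, c₁, c₁', B₁', cP, C₂, B₀β, inp, hlen, hlen1, hB₁', hBB, hc₁', hwin, hT, hP⟩ := h5
  obtain ⟨C, ε₀, hC, hε₀, h3⟩ := h7
  have hL : 2 ≤ F.L := HistoryFlow.two_le_L F
  obtain ⟨α, ℓ, hα, hα1, hα2, hα3, hα4, hα5, hgℓ, hε0, hε, hεε₀, hCε, hεr, hΛ₁, hb0, hb, hCℓ, hΛ₂', hΛ₂'0, hnum⟩ :=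
    exists_window_letters_linearLeaf F hc₁' inp B₀β g (radiusOfRecordH_pos (N := N) hL (one_le_ne3NperOfRecord₁₁ F 0 0))
      (constOfRecordH N F.L (ne3NperOfRecord₁₁ F 0 0) g) hC hε₀
  have hB0 : 0 < 5 * ((4 : ℕ) : ℝ) * F.L * inp.B₀ := by have := inp.B₀_pos; positivity
  have hΛpos : 0 < ℓ.Λ₁ := by rw [hΛ₁]; exact radiusOfRecordH_pos (N := N) hL (one_le_ne3NperOfRecord₁₁ F 0 0)
  have hgpos : 0 < ℓ.g := by rw [hgℓ]; exact hg
  refine ⟨ℓ, hgℓ, hΛ₁, hCℓ, hb0, hnum, hΛ₂'0,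
    inEndRegimeH_ofRecord_of_window F (ne3ConstLayerOfRecord₁₁ F N ℓ) (one_le_ne3NperOfRecord₁₁ F 0 0) hgpos hB0.le hα2 hε0 hε hΛ₁.le hb0.le hb
      (show constOfRecordH N F.L (ne3NperOfRecord₁₁ F 0 0) ℓ.g ≤ ℓ.C by rw [hCℓ, hgℓ]), ?_⟩
  have hCε0 : 0 ≤ C * ℓ.ε := mul_nonneg hC hε0.le
  exact leafSlotHolderAT_ofRecord_of_window_linear F (ne3ConstLayerOfRecord₁₁ F N ℓ) hlen hlen1 hB₁' hBB hc₁' hwin hα hα1 hα2 hα3 hα4 hα5 hε hΛpos hΛ₂' hCε0 hCε hCε0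
    (hCε.trans (by linarith only [hα.le] : α / 2048 ≤ α / 24)) hT hP (h3 ℓ.ε hε0 hεε₀)

end Holder

/-! ## §3 Multi-scale (R-β″): letters with the MS proviso, the AT-keyed MS slot and N21's numerals, per family -/

section HolderMS

variable {β : ℝ}

/-- **PER FAMILY, R-β″: LETTERS WITH THE MS PROVISO, THE MS SLOT, AND N21's NUMERALS, FROM THE TWO IN-EDGES** — as §2 with N05's family at exponent `β`, the MS length letter
`len (j • e μ) = j`, and module 24's thresholds `radiusOfRecordHMS` ∕ `constOfRecordHMS` (module 26's `inEndRegimeHMS_ofRecord_of_window`, module 33's `leafSlotHolderMSAT_ofRecord_of_window_linear`).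
[folklore] -/
theorem exists_letters_inEndRegimeHMS_leafSlotHolderMSAT_of_edges (F : T4Family) {g : ℝ} (hg : 0 < g)
    (h5 : letI : CStarAlgebra (Matrix (Fin N) (Fin N) ℂ) := {}
      ∃ (len : Site 4 → ℝ) (c₁ c₁' B₁' cP C₂ B₀β : ℝ) (inp : B8.B9Inputs),
        (∀ v : Site 4, 0 < len v → 1 ≤ len v) ∧ (∀ (μ : Fin 4) (j : ℕ), len (j • e μ) = j) ∧ 0 < B₁' ∧ 5 * ((4 : ℕ) : ℝ) * F.L * inp.B₀ ≤ B₁' ∧ 0 < c₁' ∧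
        (∀ α₀ α₁ : ℝ, 0 < α₀ → 0 < α₁ → α₀ + α₁ ≤ c₁' →
          α₀ + α₁ ≤ c₁ ∧ C0 4 * (2 * α₀) ≤ 1 / 3 ∧ 4 * α₀ ≤ c2' 4 F.L ∧ 16 * (B₁' * (α₀ + α₁)) ≤ 1 ∧
          Real.exp (4 * (800 * (((4 : ℕ) : ℝ) + 1) ^ 2 * (((4 : ℕ) : ℝ) + 4)) * α₀) * (1 + 8 * (131072 * (((4 : ℕ) : ℝ) + 1) ^ 2) * (B₁' * (α₀ + α₁))) ≤ 2 ∧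
          2 * (B₁' * (α₀ + α₁)) ≤ c3 4 F.L ∧ ((4 : ℕ) : ℝ) * F.L * α₁ ≤ 1 / 8 ∧ α₀ ≤ cP ∧ α₁ ≤ cP ∧ B₁' * (α₀ + α₁) ≤ cP ∧
          2 * (B₁' * (α₀ + α₁)) ^ 2 + 20 * ((4 : ℕ) : ℝ) * α₀ * (B₁' * (α₀ + α₁)) + 2 * C₂ * (B₁' * (α₀ + α₁)) ^ 2 ≤ α₀ + α₁) ∧
        B8.Thm4Body c₁ B₁' (fun i : {i : ZdIdx 4 F.L // (∀ j, i.Ω j = Set.univ) ∧ (∀ m j, i.Λs m j = {_y | j = m}) ∧ (∀ m j, i.Λb m j = {_c | j = m}) ∧ i.η = ((F.L : ℝ)⁻¹) ^ i.k} => (zdGF3 (Matrix (Fin N) (Fin N) ℂ) F.L β len i.1).toGFData) ∧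
        B8.Prop3Body cP 4 (F.L : ℝ) C₂ inp B₀β (fun i : {i : ZdIdx 4 F.L // (∀ j, i.Ω j = Set.univ) ∧ (∀ m j, i.Λs m j = {_y | j = m}) ∧ (∀ m j, i.Λb m j = {_c | j = m}) ∧ i.η = ((F.L : ℝ)⁻¹) ^ i.k} => (zdGF3 (Matrix (Fin N) (Fin N) ℂ) F.L β len i.1).toGFData2))
    (h7 : ∃ C ε₀ : ℝ, 0 ≤ C ∧ 0 < ε₀ ∧ ∀ ε : ℝ, 0 < ε → ε ≤ ε₀ →
      LeafH3sup 4 F.L (ne3NperOfRecord₁₁ F 0 0) ε (C * ε) (C * ε) (ne3DomOfRecord₁₁ F N 0 0)) :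
    ∃ ℓ : NE3Letters₁₁, ℓ.g = g ∧ ℓ.Λ₁ = radiusOfRecordHMS N F.L (ne3NperOfRecord₁₁ F 0 0) ∧ ℓ.C = constOfRecordHMS N F.L (ne3NperOfRecord₁₁ F 0 0) g ∧
      0 < ℓ.b ∧ 512 * (4 + 1) * (4 + 4) * (F.L : ℝ) ^ 2 * ℓ.b ≤ 1 ∧ 0 < ℓ.Λ₂' ∧
      InEndRegimeHMS (ne3OfRecord₁₁ F (ne3ConstLayerOfRecord₁₁ F N ℓ)) ∧ LeafSlotHolderMSAT (ne3OfRecord₁₁ F (ne3ConstLayerOfRecord₁₁ F N ℓ)) β := by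
  letI : CStarAlgebra (Matrix (Fin N) (Fin N) ℂ) := {}
  obtain ⟨len, c₁, c₁', B₁', cP, C₂, B₀β, inp, hlen, hlenj, hB₁', hBB, hc₁', hwin, hT, hP⟩ := h5
  obtain ⟨C, ε₀, hC, hε₀, h3⟩ := h7
  have hL : 2 ≤ F.L := HistoryFlow.two_le_L F
  obtain ⟨α, ℓ, hα, hα1, hα2, hα3, hα4, hα5, hgℓ, hε0, hε, hεε₀, hCε, hεr, hΛ₁, hb0, hb, hCℓ, hΛ₂', hΛ₂'0, hnum⟩ :=
    exists_window_letters_linearLeaf F hc₁' inp B₀β g (radiusOfRecordHMS_pos (N := N) hL (one_le_ne3NperOfRecord₁₁ F 0 0))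
      (constOfRecordHMS N F.L (ne3NperOfRecord₁₁ F 0 0) g) hC hε₀
  have hB0 : 0 < 5 * ((4 : ℕ) : ℝ) * F.L * inp.B₀ := by have := inp.B₀_pos; positivity
  have hΛpos : 0 < ℓ.Λ₁ := by rw [hΛ₁]; exact radiusOfRecordHMS_pos (N := N) hL (one_le_ne3NperOfRecord₁₁ F 0 0)
  have hgpos : 0 < ℓ.g := by rw [hgℓ]; exact hg
  refine ⟨ℓ, hgℓ, hΛ₁, hCℓ, hb0, hnum, hΛ₂'0,
    inEndRegimeHMS_ofRecord_of_window F (ne3ConstLayerOfRecord₁₁ F N ℓ) (one_le_ne3NperOfRecord₁₁ F 0 0) hgpos hB0.le hα2 hε0 hε hΛ₁.le hb0.le hb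
      (show constOfRecordHMS N F.L (ne3NperOfRecord₁₁ F 0 0) ℓ.g ≤ ℓ.C by rw [hCℓ, hgℓ]), ?_⟩
  have hCε0 : 0 ≤ C * ℓ.ε := mul_nonneg hC hε0.le
  exact leafSlotHolderMSAT_ofRecord_of_window_linear F (ne3ConstLayerOfRecord₁₁ F N ℓ) hlen hlenj hB₁' hBB hc₁' hwin hα hα1 hα2 hα3 hα4 hα5 hε hΛpos hΛ₂' hCε0 hCε
    hCε0 (hCε.trans (by linarith only [hα.le] : α / 2048 ≤ α / 24)) hT hP (h3 ℓ.ε hε0 hεε₀)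

end HolderMS

end

end Summit.QuantumFields.YangMills.BalabanUVNodes.N16LettersOfEdgesAllTorus
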